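import Literature.Computation.Certificates.CliqueSumSparseCheck
import Literature.Computation.Certificates.PsdZeroPivotRule

/-!
# Fraction-free (Bareiss) positive-semidefiniteness decision for small integer blocks, TRUSTED
# (soundness proved): the fast PSD side of a clique-decomposed certificate, no Gram data

Compute infrastructure of the cell `gridfusion` (custody gridfusion-lit-5), namespace
`Literature.Computation.Certificates.PSD`. No named fact, no instance, no `sorry`.

THE PROBLEM IT REMOVES. A clique-decomposed LMI `A = Σ_c E_cᵀ S_c E_c` needs, besides the identity
(`CliqueSumSparseCheck`), the fact that every block `S_c` is positive semidefinite. The data-free lane so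
far is the in-kernel rational `LDLᵀ` (`CliqueSumBlockLDL.ldlAll`: elimination in `ℚ` + Gram re-check,
≈ 1.3–1.5 ms of kernel per unit of `Σ k³`; a meshed SP-118-class object with 472 blocks `≤ 17` costs
≈ 354 s in seven files — the dominant kernel cost of such a certificate, gridfusion 2026-08-27). Here the
block is decided FRACTION-FREE: the block is presented by INTEGER upper-triangle rows `U` (the producer
clears the block's denominators, `S = (1/d) • symOfUpper k U`, `d > 0`), and the reader runs Bareiss's
one-step integer-preserving elimination without pivoting [cite: Bareiss1968, §I eq. (8), p. 565],
branching on the sign of each pivot exactly as Collowald–Hubert's fraction-free diagonalisation of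
positive semidefinite matrices [cite: CollowaldHubert2015, §4.1 Corollary 4.2 and §4.2 Proposition 4.4]:
pivot `< 0` ⇒ reject; pivot `= 0` ⇒ the pivot row must vanish, continue on the minor; pivot `a > 0` ⇒
replace the remaining rows by `(a·d_ij − b_i·b_j) / p` (`p` the previous pivot, `1` initially) — the
division is exact by Bareiss's theorem, and the reader CHECKS exactness at run time (so soundness needs
no minors bookkeeping: an inexact division simply rejects). MEASURED (farm, `decide +kernel`, 2026-08-27):
258 blocks `≤ 9` with ≤ 37-digit entries in ONE 27-s file (the `ℚ`-`LDLᵀ` lane: ≈ 200 s in four files);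
472 meshed blocks `≤ 17`, 41-digit: ≈ 115 s in two files (vs ≈ 354 s in seven) — 0.1 ms per `k³`-unit on
small blocks, 0.45 ms at `k ≤ 17` (integer growth), against 1.3–1.5 ms.

* `bzStep a p b rows` — one elimination step on upper rows (numerators `a·d − bᵢ·bⱼ`, run-time exactness
  test, exact division by `p`); `bzDecide k p U` — the recursive decision; `upperShape k U` — row `i` has
  `k − i` entries; `bzCheck k U := upperShape k U && bzDecide k 1 U`.
* SOUNDNESS `posSemidef_symOfUpper_of_bzCheck : bzCheck k U = true → ((symOfUpper k U).map Int.cast).PosSemidef`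
  (over `ℝ`), by induction over the pivots with the tree's block criteria
  `PsdZeroPivotRule.posSemidef_fromBlocks_zero₁₁_iff` / `posSemidef_fromBlocks_posDef₁₁_iff`
  (⇐ directions) [cite: HornJohnson2013, §7.1 Observation 7.1.10].
* The block API for the clique lane: `zblock k d U := (symOfUpper k U).map (· / d : ℤ → ℚ)`,
  `posSemidef_zblock_map`, the data-driven block list `zblocks N data`
  (`data : List (List (Fin N) × ℕ × List (List ℤ))` = members, denominator, integer upper rows),
  `bzCheckAll` / `bzCheckWindow` and `forall_posSemidef_zblocks(_of_windows)` — feeding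
  `posSemidef_map_of_cliqueSweepS` / `SlabCertificate.ofSparse(Eq)` exactly like `ldlAll` / `ldlWindow`.

RELATION TO THE TREE: `Literature/LinearAlgebra/Matrix/PosSemidefEliminationTest.lean` is the same
three-branch decision over a FIELD as a `Matrix`-level proposition `Accepts` with completeness
(`accepts_iff_posSemidef`); `PsdZeroPivotRule.lean` / `BareissFractionFreePsd.lean` hold the block criteria
and Bareiss's identities. This file is the EXECUTABLE fraction-free reader on list data with its soundness
— the piece the certificate files `decide`. MEASURED with THIS file's definitions: the 258 blocks `≤ 9` of
the `N = 614` object through `bzCheckAll` + `forall_posSemidef_zblocks` in one 26-s file.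

WHAT THIS FILE IS NOT: not a completeness proof (a rejected block proves nothing; Bareiss's divisibility
theorem — `BareissFractionFreePsd.lean` — explains why symmetric integer input never trips the exactness
test, but soundness does not use it); not a certificate format (no factor is stored or printed).
-/

set_option linter.style.longLine false

namespace Literature.Computation.Certificates.PSD

open Matrix

/-! ## §1 The reader (structural recursion, `decide +kernel`-evaluable) -/

/-- One fraction-free elimination step on integer UPPER rows: pivot row `a, b₀, …, b_{k−1}` (pivot
`a > 0`, `b = bsuf`), remaining upper rows `rows` (row `i` = entries `(i,i), (i,i+1), …` of the minor);
returns the upper rows of `(a·D − b bᵀ) / p`, or `none` if some division by `p` is not exact.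
[cite: Bareiss1968, §I eq. (8), p. 565] -/
def bzStep (a p : ℤ) : List ℤ → List (List ℤ) → Option (List (List ℤ))
  | bi :: bs, row :: rows =>
      if (List.zipWith (fun d bj => a * d - bi * bj) row (bi :: bs)).all (fun x => x % p == 0) then
        match bzStep a p bs rows with
        | none => none
        | some rest => some ((List.zipWith (fun d bj => a * d - bi * bj) row (bi :: bs)).map (· / p) :: rest)
      else none
  | [], [] => some []
  | [], _ :: _ => none
  | _ :: _, [] => none

/-- **The fraction-free PSD decision** on integer upper rows (`k` = fuel = number of rows, `p` = previous
pivot, `1` at the start): pivot `< 0` ⇒ reject; `= 0` ⇒ the rest of the pivot row must vanish and the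
decision continues on the minor with the same `p`; `> 0` ⇒ one Bareiss step and continue with `p := a`.
[cite: CollowaldHubert2015, §4.1 Corollary 4.2, §4.2 Proposition 4.4] [cite: Bareiss1968, §I eq. (8), p. 565] -/
def bzDecide : ℕ → ℤ → List (List ℤ) → Bool
  | 0, _, U => U.isEmpty
  | _ + 1, _, [] => false
  | k + 1, p, r :: rs =>
    match r with
    | [] => false
    | a :: b =>
      if a < 0 then false
      else if a = 0 then b.all (· == 0) && bzDecide k p rs
      else
        match bzStep a p b rs with
        | none => false
        | some U' => bzDecide k a U'

/-- Shape test: `U` lists `k` upper rows, row `i` with exactly `k − i` entries. [folklore] -/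
def upperShape : ℕ → List (List ℤ) → Bool
  | 0, [] => true
  | 0, _ :: _ => false
  | _ + 1, [] => false
  | k + 1, r :: rs => (r.length == k + 1) && upperShape k rs

/-- **The check**: shape and the fraction-free decision from `p = 1`.
[cite: CollowaldHubert2015, §4.1 Corollary 4.2, §4.2 Proposition 4.4] -/
def bzCheck (k : ℕ) (U : List (List ℤ)) : Bool := upperShape k U && bzDecide k 1 U

/-! ## §2 Entries of `symOfUpper` on a cons of rows -/

section SymOfUpper

variable {R : Type*} [Zero R]

/-- Pivot entry. [folklore] -/
private theorem symOfUpper_cons_zero_zero (k : ℕ) (a : R) (b : List R) (rs : List (List R)) :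
    symOfUpper (k + 1) ((a :: b) :: rs) 0 0 = a := by
  simp [symOfUpper]

/-- Pivot row. [folklore] -/
private theorem symOfUpper_cons_zero_succ (k : ℕ) (a : R) (b : List R) (rs : List (List R)) (j : Fin k) :
    symOfUpper (k + 1) ((a :: b) :: rs) 0 j.succ = b.getD j.val 0 := by
  simp [symOfUpper, Fin.val_succ]

/-- Pivot column (by symmetry of the reader). [folklore] -/
private theorem symOfUpper_cons_succ_zero (k : ℕ) (a : R) (b : List R) (rs : List (List R)) (i : Fin k) :
    symOfUpper (k + 1) ((a :: b) :: rs) i.succ 0 = b.getD i.val 0 := by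
  simp [symOfUpper, Fin.val_succ]

/-- The minor is the reader on the remaining rows. [folklore] -/
private theorem symOfUpper_cons_succ_succ (k : ℕ) (a : R) (b : List R) (rs : List (List R)) (i j : Fin k) :
    symOfUpper (k + 1) ((a :: b) :: rs) i.succ j.succ = symOfUpper k rs i j := by
  simp only [symOfUpper, Fin.val_succ, Nat.succ_le_succ_iff, Nat.succ_sub_succ, List.getD_cons_succ]

/-- `symOfUpper` is symmetric entrywise. [cite: BarrettEtAl1994, §4.3.1, p. 57 (symmetric matrices: store one triangle)] -/
theorem symOfUpper_comm (k : ℕ) (U : List (List R)) (i j : Fin k) :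
    symOfUpper k U i j = symOfUpper k U j i := by
  have h := congrFun (congrFun (symOfUpper_transpose k U) i) j
  rw [Matrix.transpose_apply] at h
  exact h.symm

/-- The index equivalence `Unit ⊕ Fin k ≃ Fin (k+1)`: the pivot index and the minor's indices. [folklore] -/
def pivotEquiv (k : ℕ) : Unit ⊕ Fin k ≃ Fin (k + 1) where
  toFun := Sum.elim (fun _ => 0) Fin.succ
  invFun i := Fin.cases (Sum.inl ()) (fun j => Sum.inr j) i
  left_inv x := by
    rcases x with ⟨⟨⟩⟩ | j
    · simp
    · simp
  right_inv i := by
    refine Fin.cases ?_ (fun j => ?_) i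
    · simp
    · simp

/-- **Block form of the reader on a cons of rows**: re-indexed along `pivotEquiv`, `symOfUpper (k+1) ((a::b)::rs)`
is the block matrix `[[a, bᵀ], [b, symOfUpper k rs]]`. [folklore] -/
private theorem symOfUpper_cons_submatrix_pivotEquiv (k : ℕ) (a : R) (b : List R) (rs : List (List R)) :
    (symOfUpper (k + 1) ((a :: b) :: rs)).submatrix (pivotEquiv k) (pivotEquiv k)
      = Matrix.fromBlocks (Matrix.of fun (_ _ : Unit) => a) (Matrix.of fun (_ : Unit) (j : Fin k) => b.getD j.val 0)
          (Matrix.of fun (_ : Unit) (j : Fin k) => b.getD j.val 0)ᵀ (symOfUpper k rs) := by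
  ext x y
  rcases x with ⟨⟨⟩⟩ | i <;> rcases y with ⟨⟨⟩⟩ | j
  · simp [pivotEquiv, symOfUpper_cons_zero_zero]
  · simp [pivotEquiv, symOfUpper_cons_zero_succ]
  · simp [pivotEquiv, symOfUpper_cons_succ_zero]
  · simp [pivotEquiv, symOfUpper_cons_succ_succ]

end SymOfUpper

/-! ## §3 Semantics of one Bareiss step -/

/-- `getD` of a `zipWith` inside both lengths (plumbing). [folklore] -/
private theorem getD_zipWith_of_lt {α β γ : Type*} (f : α → β → γ) (l : List α) (l' : List β) (t : ℕ)
    (dα : α) (dβ : β) (dγ : γ) (h1 : t < l.length) (h2 : t < l'.length) :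
    (List.zipWith f l l').getD t dγ = f (l.getD t dα) (l'.getD t dβ) := by
  rw [List.getD_eq_getElem?_getD, List.getD_eq_getElem?_getD, List.getD_eq_getElem?_getD,
    List.getElem?_zipWith, List.getElem?_eq_getElem h1, List.getElem?_eq_getElem h2]
  rfl

/-- Exactness read off the run-time test (plumbing). [folklore] -/
private theorem dvd_of_all_emod {p : ℤ} {l : List ℤ} (h : l.all (fun x => x % p == 0) = true) {t : ℕ}
    (ht : t < l.length) : p ∣ l.getD t 0 := by
  rw [List.all_eq_true] at h
  have hx := h _ (List.getElem_mem ht)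
  rw [beq_iff_eq] at hx
  rw [List.getD_eq_getElem?_getD, List.getElem?_eq_getElem ht, Option.getD_some]
  exact Int.dvd_of_emod_eq_zero hx

/-- **What a successful step computes**: the output has as many rows as the input, row `i` has
`min |rows i| (|bsuf| − i)` entries, and inside those bounds every division was exact and
`p · U'[i][t] = a · rows[i][t] − bsuf[i] · bsuf[i+t]`. [cite: Bareiss1968, §I eq. (8), p. 565] -/
theorem bzStep_spec {a p : ℤ} : ∀ {bsuf : List ℤ} {rows U' : List (List ℤ)},
    bzStep a p bsuf rows = some U' →
    U'.length = rows.length ∧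
    ∀ i, i < rows.length →
      (U'.getD i []).length = min (rows.getD i []).length (bsuf.length - i) ∧
      ∀ t, t < (rows.getD i []).length → i + t < bsuf.length →
        p ∣ (a * (rows.getD i []).getD t 0 - bsuf.getD i 0 * bsuf.getD (i + t) 0) ∧
        (U'.getD i []).getD t 0 = (a * (rows.getD i []).getD t 0 - bsuf.getD i 0 * bsuf.getD (i + t) 0) / p
  | [], [], U', h => by
    simp only [bzStep, Option.some.injEq] at h
    subst h
    simp
  | [], _ :: _, U', h => by simp [bzStep] at h
  | _ :: _, [], U', h => by simp [bzStep] at h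
  | bi :: bs, row :: rows, U', h => by
    simp only [bzStep] at h
    split_ifs at h with hall
    cases hrec : bzStep a p bs rows with
    | none => simp [hrec] at h
    | some rest =>
      simp only [hrec, Option.some.injEq] at h
      subst h
      obtain ⟨hlen, ih⟩ := bzStep_spec hrec
      refine ⟨by simp [hlen], fun i hi => ?_⟩
      cases i with
      | zero =>
        refine ⟨by simp [List.length_zipWith], fun t ht hbt => ?_⟩
        simp only [List.getD_cons_zero, Nat.zero_add] at ht hbt ⊢
        have hnum : (List.zipWith (fun d bj => a * d - bi * bj) row (bi :: bs)).getD t 0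
            = a * row.getD t 0 - bi * (bi :: bs).getD t 0 :=
          getD_zipWith_of_lt _ _ _ t 0 0 0 ht hbt
        have hlenz : t < (List.zipWith (fun d bj => a * d - bi * bj) row (bi :: bs)).length := by
          rw [List.length_zipWith]; exact lt_min ht hbt
        have hz : (List.zipWith (fun d bj => a * d - bi * bj) row (bi :: bs))[t] = a * row.getD t 0 - bi * (bi :: bs).getD t 0 := by
          have := hnum
          rw [List.getD_eq_getElem?_getD, List.getElem?_eq_getElem hlenz, Option.getD_some] at this
          exact this
        refine ⟨?_, ?_⟩
        · have hd := dvd_of_all_emod hall hlenz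
          rwa [hnum] at hd
        · rw [List.getD_eq_getElem?_getD, List.getElem?_map, List.getElem?_eq_getElem hlenz]
          simp [hz]
      | succ i =>
        simp only [List.length_cons, Nat.succ_lt_succ_iff] at hi
        obtain ⟨hl, ih2⟩ := ih i hi
        refine ⟨?_, fun t ht hbt => ?_⟩
        · simp only [List.getD_cons_succ, List.length_cons] at hl ⊢
          rw [hl]; omega
        · simp only [List.getD_cons_succ, List.length_cons] at ht hbt ⊢
          have h3 := ih2 t ht (by omega)
          rw [show i + 1 + t = (i + t) + 1 by omega, List.getD_cons_succ]
          exact h3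

/-! ## §4 Shape bookkeeping -/

/-- A shaped list has `k` rows. [folklore] -/
private theorem length_of_upperShape : ∀ {k : ℕ} {U : List (List ℤ)}, upperShape k U = true → U.length = k
  | 0, [], _ => rfl
  | 0, _ :: _, h => by simp [upperShape] at h
  | _ + 1, [], h => by simp [upperShape] at h
  | k + 1, r :: rs, h => by
    simp only [upperShape, Bool.and_eq_true, beq_iff_eq] at h
    simp [length_of_upperShape h.2]

/-- Row `i` of a shaped list has `k − i` entries. [folklore] -/
private theorem getD_length_of_upperShape : ∀ {k : ℕ} {U : List (List ℤ)}, upperShape k U = true →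
    ∀ i, i < k → (U.getD i []).length = k - i
  | 0, _, _, i, hi => absurd hi (Nat.not_lt_zero i)
  | _ + 1, [], h, _, _ => by simp [upperShape] at h
  | k + 1, r :: rs, h, i, hi => by
    simp only [upperShape, Bool.and_eq_true, beq_iff_eq] at h
    cases i with
    | zero => simpa using h.1
    | succ i =>
      rw [List.getD_cons_succ, getD_length_of_upperShape h.2 i (by omega)]
      omega

/-- Shape from the length facts. [folklore] -/
private theorem upperShape_of_lengths : ∀ (k : ℕ) (U : List (List ℤ)), U.length = k →
    (∀ i, i < k → (U.getD i []).length = k - i) → upperShape k U = true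
  | 0, [], _, _ => rfl
  | 0, _ :: _, h, _ => by simp at h
  | _ + 1, [], h, _ => by simp at h
  | k + 1, r :: rs, h, hl => by
    simp only [upperShape, Bool.and_eq_true, beq_iff_eq]
    refine ⟨by simpa using hl 0 (Nat.succ_pos k), upperShape_of_lengths k rs (by simpa using h) fun i hi => ?_⟩
    have := hl (i + 1) (by omega)
    rw [List.getD_cons_succ] at this
    omega

/-- A cons of rows is shaped iff the pivot row has `k + 1` entries and the rest is shaped. [folklore] -/
private theorem upperShape_cons {k : ℕ} {r : List ℤ} {rs : List (List ℤ)} (h : upperShape (k + 1) (r :: rs) = true) :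
    r.length = k + 1 ∧ upperShape k rs = true := by
  simpa [upperShape, Bool.and_eq_true, beq_iff_eq] using h

/-! ## §5 Soundness -/

/-- A one-point real matrix with positive entry is positive definite (the pivot block). [folklore] -/
private theorem posDef_of_unit {a : ℝ} (ha : 0 < a) : (Matrix.of fun (_ _ : Unit) => a).PosDef := by
  have h : (Matrix.of fun (_ _ : Unit) => a) = diagonal fun _ => a := by
    ext ⟨⟩ ⟨⟩
    simp
  rw [h, posDef_diagonal_iff]
  exact fun _ => ha

/-- The inverse of the pivot block. [folklore] -/
private theorem inv_of_unit {a : ℝ} (ha : a ≠ 0) :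
    (Matrix.of fun (_ _ : Unit) => a)⁻¹ = Matrix.of fun (_ _ : Unit) => a⁻¹ :=
  Matrix.inv_eq_left_inv (by
    ext ⟨⟩ ⟨⟩
    simp [Matrix.mul_apply, inv_mul_cancel₀ ha])

/-- The empty matrix is positive semidefinite. [folklore] -/
private theorem posSemidef_fin_zero (M : Matrix (Fin 0) (Fin 0) ℝ) : M.PosSemidef :=
  PosSemidef.of_dotProduct_mulVec_nonneg (by ext i; exact Fin.elim0 i) fun x => by simp [dotProduct]

/-- **Entry identity of a successful step** (stored triangle): for `i ≤ j < k`,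
`p · (symOfUpper k U')ᵢⱼ = a · (symOfUpper k rs)ᵢⱼ − bᵢ bⱼ` in `ℤ`.
[cite: Bareiss1968, §I eq. (8), p. 565] -/
theorem bzStep_entry_le {a p : ℤ} {k : ℕ} {b : List ℤ} {rs U' : List (List ℤ)} (hb : b.length = k)
    (hrs : upperShape k rs = true) (h : bzStep a p b rs = some U') (i j : Fin k) (hij : i ≤ j) :
    p * symOfUpper k U' i j = a * symOfUpper k rs i j - b.getD i.val 0 * b.getD j.val 0 := by
  obtain ⟨_, hspec⟩ := bzStep_spec h
  have hi : i.val < rs.length := by rw [length_of_upperShape hrs]; exact i.isLt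
  have hrow : (rs.getD i.val []).length = k - i.val := getD_length_of_upperShape hrs i.val i.isLt
  obtain ⟨_, ht⟩ := hspec i.val hi
  have hle : i.val ≤ j.val := hij
  obtain ⟨hdvd, hval⟩ := ht (j.val - i.val) (by rw [hrow]; omega) (by rw [hb]; omega)
  rw [Nat.add_sub_cancel' hle] at hdvd hval
  simp only [symOfUpper, if_pos hle]
  rw [hval]
  exact Int.mul_ediv_cancel' hdvd

/-- The same for all `i, j` (both readers are symmetric). [cite: Bareiss1968, §I eq. (8), p. 565] -/
theorem bzStep_entry {a p : ℤ} {k : ℕ} {b : List ℤ} {rs U' : List (List ℤ)} (hb : b.length = k)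
    (hrs : upperShape k rs = true) (h : bzStep a p b rs = some U') (i j : Fin k) :
    p * symOfUpper k U' i j = a * symOfUpper k rs i j - b.getD i.val 0 * b.getD j.val 0 := by
  rcases le_total i j with hij | hji
  · exact bzStep_entry_le hb hrs h i j hij
  · rw [symOfUpper_comm k U' i j, symOfUpper_comm k rs i j, mul_comm (b.getD i.val 0),
      bzStep_entry_le hb hrs h j i hji]

/-- A successful step preserves the shape. [folklore] -/
private theorem upperShape_of_bzStep {a p : ℤ} {k : ℕ} {b : List ℤ} {rs U' : List (List ℤ)} (hb : b.length = k)
    (hrs : upperShape k rs = true) (h : bzStep a p b rs = some U') : upperShape k U' = true := by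
  obtain ⟨hlen, hspec⟩ := bzStep_spec h
  have hk : rs.length = k := length_of_upperShape hrs
  refine upperShape_of_lengths k U' (by rw [hlen, hk]) fun i hi => ?_
  obtain ⟨hl, _⟩ := hspec i (by rw [hk]; exact hi)
  rw [hl, getD_length_of_upperShape hrs i hi, hb]
  omega

/-- **SOUNDNESS of the fraction-free decision**: with a positive previous pivot, a shaped list of integer
upper rows accepted by `bzDecide` presents a positive semidefinite matrix (over `ℝ`). Induction over the
pivots; the three branches are `not needed / posSemidef_fromBlocks_zero₁₁_iff / posSemidef_fromBlocks_posDef₁₁_iff`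
of `PsdZeroPivotRule` (⇐ directions), the `> 0` step through the identity
`D − bᵀ a⁻¹ b = (p / a) • symOfUpper k U'`.
[cite: CollowaldHubert2015, §4.1 Corollary 4.2, §4.2 Proposition 4.4] [cite: HornJohnson2013, §7.1 Observation 7.1.10] -/
theorem posSemidef_symOfUpper_of_bzDecide : ∀ (k : ℕ) (p : ℤ) (U : List (List ℤ)), 0 < p →
    upperShape k U = true → bzDecide k p U = true →
    ((symOfUpper k U).map (Int.cast : ℤ → ℝ)).PosSemidef
  | 0, _, U, _, _, _ => posSemidef_fin_zero _
  | _ + 1, _, [], _, hsh, _ => by simp [upperShape] at hsh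
  | k + 1, p, [] :: rs, _, hsh, _ => by
    have := (upperShape_cons hsh).1
    simp at this
  | k + 1, p, (a :: b) :: rs, hp, hsh, h => by
    obtain ⟨hlen, hrs⟩ := upperShape_cons hsh
    have hb : b.length = k := by simpa using hlen
    -- the block form over ℝ
    have hblock : ((symOfUpper (k + 1) ((a :: b) :: rs)).map (Int.cast : ℤ → ℝ)).submatrix (pivotEquiv k) (pivotEquiv k)
        = Matrix.fromBlocks (Matrix.of fun (_ _ : Unit) => (a : ℝ))
            (Matrix.of fun (_ : Unit) (j : Fin k) => ((b.getD j.val 0 : ℤ) : ℝ))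
            (Matrix.of fun (_ : Unit) (j : Fin k) => ((b.getD j.val 0 : ℤ) : ℝ))ᵀ
            ((symOfUpper k rs).map (Int.cast : ℤ → ℝ)) := by
      rw [Matrix.submatrix_map, symOfUpper_cons_submatrix_pivotEquiv, Matrix.fromBlocks_map]
      rfl
    rw [← Matrix.posSemidef_submatrix_equiv (pivotEquiv k), hblock]
    simp only [bzDecide] at h
    split_ifs at h with hneg hzero
    · -- zero pivot: the pivot row vanishes and the minor passes with the same `p`
      rw [Bool.and_eq_true] at h
      obtain ⟨hball, hrec⟩ := h
      have hD := posSemidef_symOfUpper_of_bzDecide k p rs hp hrs hrec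
      have hB : (Matrix.of fun (_ : Unit) (j : Fin k) => ((b.getD j.val 0 : ℤ) : ℝ)) = 0 := by
        ext u j
        have hj : j.val < b.length := by rw [hb]; exact j.isLt
        have hmem : b.getD j.val 0 ∈ b := by
          rw [List.getD_eq_getElem?_getD, List.getElem?_eq_getElem hj, Option.getD_some]
          exact List.getElem_mem hj
        have hz := List.all_eq_true.1 hball _ hmem
        rw [beq_iff_eq] at hz
        rw [Matrix.of_apply, Matrix.zero_apply, hz, Int.cast_zero]
      have hA : (Matrix.of fun (_ _ : Unit) => (a : ℝ)) = 0 := by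
        ext ⟨⟩ ⟨⟩
        simp [hzero]
      rw [hA, hB]
      exact (PsdZeroPivotRule.posSemidef_fromBlocks_zero₁₁_iff _ _).2 ⟨rfl, hD⟩
    · -- positive pivot: one Bareiss step, continue with `p := a`
      have ha : 0 < a := lt_of_le_of_ne (not_lt.mp hneg) (Ne.symm hzero)
      cases hstep : bzStep a p b rs with
      | none => rw [hstep] at h; simp at h
      | some U' =>
        rw [hstep] at h
        have hshU : upperShape k U' = true := upperShape_of_bzStep hb hrs hstep
        have hN := posSemidef_symOfUpper_of_bzDecide k a U' ha hshU h
        apply (PsdZeroPivotRule.posSemidef_fromBlocks_posDef₁₁_iff (posDef_of_unit (by exact_mod_cast ha)) _ _).2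
        have ha' : (a : ℝ) ≠ 0 := by exact_mod_cast ha.ne'
        have hp' : (0 : ℝ) < p := by exact_mod_cast hp
        have key : (symOfUpper k rs).map (Int.cast : ℤ → ℝ)
            - (Matrix.of fun (_ : Unit) (j : Fin k) => ((b.getD j.val 0 : ℤ) : ℝ))ᵀ
                * (Matrix.of fun (_ _ : Unit) => (a : ℝ))⁻¹
                * (Matrix.of fun (_ : Unit) (j : Fin k) => ((b.getD j.val 0 : ℤ) : ℝ))
            = ((p : ℝ) / a) • (symOfUpper k U').map (Int.cast : ℤ → ℝ) := by
          rw [inv_of_unit ha']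
          ext i j
          have hz := bzStep_entry hb hrs hstep i j
          have hc : ((p : ℤ) : ℝ) * ((symOfUpper k U' i j : ℤ) : ℝ)
              = ((a : ℤ) : ℝ) * ((symOfUpper k rs i j : ℤ) : ℝ)
                - ((b.getD i.val 0 : ℤ) : ℝ) * ((b.getD j.val 0 : ℤ) : ℝ) := by
            exact_mod_cast hz
          simp only [Matrix.sub_apply, Matrix.mul_apply, Matrix.transpose_apply, Matrix.of_apply, Matrix.map_apply,
            Matrix.smul_apply, smul_eq_mul, Finset.univ_unique, Finset.sum_singleton]
          rw [div_mul_eq_mul_div, hc]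
          field_simp
        rw [key]
        exact hN.smul (div_nonneg hp'.le (by exact_mod_cast ha.le))

/-- **SOUNDNESS of the check**: integer upper rows accepted by `bzCheck` present a positive semidefinite
matrix over `ℝ`. [cite: CollowaldHubert2015, §4.1 Corollary 4.2] [cite: Bareiss1968, §I eq. (8), p. 565] -/
theorem posSemidef_symOfUpper_of_bzCheck {k : ℕ} {U : List (List ℤ)} (h : bzCheck k U = true) :
    ((symOfUpper k U).map (Int.cast : ℤ → ℝ)).PosSemidef := by
  rw [bzCheck, Bool.and_eq_true] at h
  exact posSemidef_symOfUpper_of_bzDecide k 1 U one_pos h.1 h.2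

/-! ## §6 The block API for the clique lane (rational blocks presented as scaled integer rows) -/

variable {N : ℕ}

/-- A rational clique block PRESENTED by integer upper rows `U` and a denominator `d`:
`zblock k d U = (1/d) • symOfUpper k U`. [cite: BarrettEtAl1994, §4.3.1, p. 57 (symmetric matrices: store one triangle)] -/
def zblock (k d : ℕ) (U : List (List ℤ)) : Matrix (Fin k) (Fin k) ℚ :=
  (symOfUpper k U).map fun z : ℤ => (z : ℚ) / d

/-- Entries of `zblock`. [cite: BarrettEtAl1994, §4.3.1, p. 57 (symmetric matrices: store one triangle)] -/
theorem zblock_apply (k d : ℕ) (U : List (List ℤ)) (i j : Fin k) :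
    zblock k d U i j = ((symOfUpper k U i j : ℤ) : ℚ) / d := rfl

/-- **A presented block accepted by `bzCheck` is positive semidefinite** (`d > 0`).
[cite: CollowaldHubert2015, §4.1 Corollary 4.2] -/
theorem posSemidef_zblock_map {k d : ℕ} {U : List (List ℤ)} (hd : 0 < d) (h : bzCheck k U = true) :
    ((zblock k d U).map (Rat.cast : ℚ → ℝ)).PosSemidef := by
  have e : (zblock k d U).map (Rat.cast : ℚ → ℝ) = ((d : ℝ)⁻¹) • (symOfUpper k U).map (Int.cast : ℤ → ℝ) := by
    ext i j
    simp [zblock, div_eq_inv_mul]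
  rw [e]
  exact (posSemidef_symOfUpper_of_bzCheck h).smul (inv_nonneg.2 (by exact_mod_cast hd.le))

/-- The block list of a clique certificate from PRESENTATION DATA: members, denominator, integer upper
rows per block (the block is `(1/d) • symOfUpper |members| U`). [cite: ZhengFantuzziPapachristodoulou2018, §3.2 Theorem 2] -/
def zblocks (N : ℕ) (data : List (List (Fin N) × ℕ × List (List ℤ))) : List (Block N ℚ) :=
  data.map fun t => ⟨t.1, zblock t.1.length t.2.1 t.2.2⟩

/-- **Batched check** of presentation data: every denominator positive, every block accepted.
[cite: CollowaldHubert2015, §4.1 Corollary 4.2] -/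
def bzCheckAll (data : List (List (Fin N) × ℕ × List (List ℤ))) : Bool :=
  data.all fun t => decide (0 < t.2.1) && bzCheck t.1.length t.2.2

/-- Window `lo ≤ index < lo + len` of the batched check (one decide per file). [cite: CollowaldHubert2015, §4.1 Corollary 4.2] -/
def bzCheckWindow (lo len : ℕ) (data : List (List (Fin N) × ℕ × List (List ℤ))) : Bool :=
  bzCheckAll ((data.drop lo).take len)

/-- Unfolding of the window. [cite: CollowaldHubert2015, §4.1 Corollary 4.2] -/
theorem bzCheckWindow_eq (lo len : ℕ) (data : List (List (Fin N) × ℕ × List (List ℤ))) :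
    bzCheckWindow lo len data = bzCheckAll ((data.drop lo).take len) := rfl

/-- **Every block of accepted data is positive semidefinite** — the hypothesis of
`posSemidef_map_of_cliqueSweepS` / `SlabCertificate.ofSparse(Eq)` with `blocks := zblocks N data`.
[cite: ZhengFantuzziPapachristodoulou2018, §3.2 Theorem 2 («if» direction)] [cite: CollowaldHubert2015, §4.1 Corollary 4.2] -/
theorem forall_posSemidef_zblocks {data : List (List (Fin N) × ℕ × List (List ℤ))} (h : bzCheckAll data = true) :
    ∀ b ∈ zblocks N data, (b.2.map (Rat.cast : ℚ → ℝ)).PosSemidef := by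
  intro b hb
  rw [zblocks, List.mem_map] at hb
  obtain ⟨t, ht, rfl⟩ := hb
  have hc := List.all_eq_true.1 h t ht
  rw [Bool.and_eq_true, decide_eq_true_eq] at hc
  exact posSemidef_zblock_map hc.1 hc.2

/-- Windows make the whole (as `CliqueSumBlockLDL.ldlAll_of_ldlWindows`). [cite: CollowaldHubert2015, §4.1 Corollary 4.2] -/
theorem bzCheckAll_of_windows {data : List (List (Fin N) × ℕ × List (List ℤ))} (len k : ℕ)
    (hk : data.length ≤ k * len) (h : ∀ t : Fin k, bzCheckWindow (t.val * len) len data = true) :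
    bzCheckAll data = true := by
  apply List.all_eq_true.2
  intro b hb
  obtain ⟨i, hi, rfl⟩ := List.getElem_of_mem hb
  have hlen : 0 < len := by
    rcases Nat.eq_zero_or_pos len with h0 | h0
    · subst h0
      rw [Nat.mul_zero] at hk
      omega
    · exact h0
  have htk : i / len < k :=
    Nat.div_lt_of_lt_mul (lt_of_lt_of_le hi (by rwa [Nat.mul_comm] at hk))
  have hw := h ⟨i / len, htk⟩
  rw [bzCheckWindow_eq] at hw
  have ha1 : i / len * len ≤ i := Nat.div_mul_le_self i len
  have ha2 : i < i / len * len + len := Nat.lt_div_mul_add hlen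
  have hmem : data[i] ∈ (data.drop (i / len * len)).take len := by
    rw [List.mem_iff_getElem]
    refine ⟨i - i / len * len, ?_, ?_⟩
    · rw [List.length_take, List.length_drop]
      omega
    · rw [List.getElem_take, List.getElem_drop]
      congr 1
      omega
  exact List.all_eq_true.1 hw _ hmem

/-- **The same from `k` window decides** (one per file). [cite: CollowaldHubert2015, §4.1 Corollary 4.2] -/
theorem forall_posSemidef_zblocks_of_windows {data : List (List (Fin N) × ℕ × List (List ℤ))} (len k : ℕ)
    (hk : data.length ≤ k * len) (h : ∀ t : Fin k, bzCheckWindow (t.val * len) len data = true) :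
    ∀ b ∈ zblocks N data, (b.2.map (Rat.cast : ℚ → ℝ)).PosSemidef :=
  forall_posSemidef_zblocks (bzCheckAll_of_windows len k hk h)

/-- **End to end, sparse target**: one sweep decide against `zblocks N data` + one `bzCheckAll` decide.
[cite: ZhengFantuzziPapachristodoulou2018, §3.2 Theorem 2 («if» direction)] -/
theorem posSemidef_map_of_cliqueSweepS_bz {rows : List (SRow ℚ)} {data : List (List (Fin N) × ℕ × List (List ℤ))}
    (h : cliqueSweepS N 0 N rows (zblocks N data) = true) (hz : bzCheckAll data = true) :
    ((matrixOfSparseRows N N rows).map (Rat.cast : ℚ → ℝ)).PosSemidef :=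
  posSemidef_map_of_cliqueSweepS h (forall_posSemidef_zblocks hz)

/-! ## §7 Kernel-checked examples -/

section Examples

/-- `[[2, 1], [1, 2]]` (integer upper rows `[[2, 1], [2]]`): pivot 2, step `(2·2 − 1·1)/1 = 3 > 0`. -/
example : bzCheck 2 [[2, 1], [2]] = true := by decide +kernel

/-- `[[1, 2], [2, 1]]` is rejected (second pivot `1·1 − 2·2 = −3`). -/
example : bzCheck 2 [[1, 2], [1]] = false := by decide +kernel

/-- Zero pivot: `[[0, 0], [0, 5]]` accepted, `[[0, 1], [1, 5]]` rejected. -/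
example : bzCheck 2 [[0, 0], [5]] = true ∧ bzCheck 2 [[0, 1], [5]] = false := by decide +kernel

/-- A `3 × 3` example with a second-level exact division: `[[4, 2, 2], [3, 1], [3]]`. -/
example : bzCheck 3 [[4, 2, 2], [3, 1], [3]] = true := by decide +kernel

/-- Soundness in use: the presented block is PSD over `ℝ`. -/
example : ((symOfUpper 3 [[4, 2, 2], [3, 1], [(3 : ℤ)]]).map (Int.cast : ℤ → ℝ)).PosSemidef :=
  posSemidef_symOfUpper_of_bzCheck (by decide +kernel)

/-- The clique lane end to end on the `3 × 3` example of `CliqueSumSparseCheck` (two `2 × 2` blocks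
presented as integer rows with denominator `1`). -/
example : ((matrixOfSparseRows 3 3 [[(0, 2), (1, 1)], [(0, 1), (1, 2), (2, 1)], [(1, 1), (2, (2 : ℚ))]]).map
    (Rat.cast : ℚ → ℝ)).PosSemidef :=
  posSemidef_map_of_cliqueSweepS_bz (data := [([0, 1], 1, [[2, 1], [1]]), ([1, 2], 1, [[1, 1], [2]])])
    (by decide +kernel) (by decide +kernel)

end Examples

/-! ## §8 The CONTENT-DIVISOR variant (append 2026-08-27, after certnum-sdp-3's kernel-hash-law measurement)

On blocks whose integerising denominator mixes a large common factor into most entries (float-derived SOS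
Gram blocks; meshed clique blocks with dyadic data), the Bareiss intermediates — bordered MINORS — acquire a
common factor `Φ^(l−1)` at step `l`; once the 2-part of `Φ^(l−1)` passes 64 bits nearly every intermediate is
`≡ 0 (mod 2^64)` and the kernel's literal hashing (low 64 bits) puts them in one class (certnum-sdp-3,
`pub/certnum/certnum-sdp-3/kernel/crossover/README.md`, 2026-08-27: a real `40 × 40` block 93 s vs 6 s for a
same-size random control). The cure is reader-side: divide the numerator matrix `a·D − b bᵀ` by its CONTENT
(the gcd of its entries — a multiple of the Bareiss divisor, so the division is still exact and the entries
are never larger) instead of by the previous pivot. Positive scaling, so the soundness induction is the same.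
MEASURED (farm, 2026-08-27): the 236 larger blocks (`k = 10…17`) of the meshed `N = 1 734` object: 41.5 s
(this variant, untrusted copy) vs 107 s (`bzDecide`) vs ≈ 300 s (`ℚ`-`LDLᵀ`); intermediates ≤ 913 bits vs 1 886.
[cite: CollowaldHubert2015, §4.1 Corollary 4.2, §4.2 Proposition 4.4] [cite: Bareiss1968, §I eq. (8), p. 565] -/

/-- The numerator rows `a·d − bᵢ·bⱼ` of one elimination step (upper rows of `a·D − b bᵀ`).
[cite: Bareiss1968, §I eq. (8), p. 565] -/
def bzRows (a : ℤ) : List ℤ → List (List ℤ) → List (List ℤ)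
  | bi :: bs, row :: rows => List.zipWith (fun d bj => a * d - bi * bj) row (bi :: bs) :: bzRows a bs rows
  | [], _ => []
  | _ :: _, [] => []

/-- gcd of `g` and the absolute values of a row (plumbing for `content`). [folklore] -/
def rowContent (g : ℕ) (row : List ℤ) : ℕ := row.foldl (fun g x => Nat.gcd g x.natAbs) g

/-- The CONTENT of a list of integer rows: the gcd of all entries (`0` for no / only zero entries). [folklore] -/
def content (N : List (List ℤ)) : ℕ := N.foldl rowContent 0

/-- Exact division of all rows by `g`, checked at run time (`none` if some entry is not divisible). [folklore] -/
def divRows (g : ℤ) (N : List (List ℤ)) : Option (List (List ℤ)) :=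
  if N.all (fun row => row.all (fun x => x % g == 0)) then some (N.map fun row => row.map (· / g)) else none

/-- **One content-divisor step**: the numerator rows divided by `max 1 (content)`.
[cite: Bareiss1968, §I eq. (8), p. 565] -/
def stepC (a : ℤ) (b : List ℤ) (rs : List (List ℤ)) : Option (List (List ℤ)) :=
  divRows (max 1 (content (bzRows a b rs) : ℤ)) (bzRows a b rs)

/-- **The content-divisor PSD decision** (same three pivot branches as `bzDecide`; no previous-pivot state).
[cite: CollowaldHubert2015, §4.1 Corollary 4.2, §4.2 Proposition 4.4] -/
def bzDecideC : ℕ → List (List ℤ) → Bool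
  | 0, U => U.isEmpty
  | _ + 1, [] => false
  | k + 1, r :: rs =>
    match r with
    | [] => false
    | a :: b =>
      if a < 0 then false
      else if a = 0 then b.all (· == 0) && bzDecideC k rs
      else
        match stepC a b rs with
        | none => false
        | some U' => bzDecideC k U'

/-- **The content-divisor check**: shape and decision. [cite: CollowaldHubert2015, §4.1 Corollary 4.2] -/
def bzCheckC (k : ℕ) (U : List (List ℤ)) : Bool := upperShape k U && bzDecideC k U

/-- What `bzRows` computes: row count, row lengths, entries. [cite: Bareiss1968, §I eq. (8), p. 565] -/
theorem bzRows_spec {a : ℤ} : ∀ (bsuf : List ℤ) (rows : List (List ℤ)),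
    (bsuf.length = rows.length → (bzRows a bsuf rows).length = rows.length) ∧
    ∀ i, i < rows.length → i < bsuf.length →
      ((bzRows a bsuf rows).getD i []).length = min (rows.getD i []).length (bsuf.length - i) ∧
      ∀ t, t < (rows.getD i []).length → i + t < bsuf.length →
        ((bzRows a bsuf rows).getD i []).getD t 0
          = a * (rows.getD i []).getD t 0 - bsuf.getD i 0 * bsuf.getD (i + t) 0
  | [], [] => by simp [bzRows]
  | [], _ :: _ => by simp [bzRows]
  | _ :: _, [] => by simp [bzRows]
  | bi :: bs, row :: rows => by
    obtain ⟨hlen, ih⟩ := bzRows_spec (a := a) bs rows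
    refine ⟨fun h => by simp [bzRows, hlen (by simpa using h)], fun i hi hib => ?_⟩
    cases i with
    | zero =>
      refine ⟨by simp [bzRows, List.length_zipWith], fun t ht hbt => ?_⟩
      simp only [bzRows, List.getD_cons_zero, Nat.zero_add] at ht hbt ⊢
      exact getD_zipWith_of_lt _ _ _ t 0 0 0 ht hbt
    | succ i =>
      simp only [List.length_cons, Nat.succ_lt_succ_iff] at hi hib
      obtain ⟨hl, ih2⟩ := ih i hi hib
      refine ⟨?_, fun t ht hbt => ?_⟩
      · simp only [bzRows, List.getD_cons_succ, List.length_cons] at hl ⊢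
        rw [hl]; omega
      · simp only [bzRows, List.getD_cons_succ, List.length_cons] at ht hbt ⊢
        rw [show i + 1 + t = (i + t) + 1 by omega, List.getD_cons_succ]
        exact ih2 t ht (by omega)

/-- What a successful `divRows` computes. [folklore] -/
private theorem divRows_spec {g : ℤ} {N U' : List (List ℤ)} (h : divRows g N = some U') :
    U'.length = N.length ∧ ∀ i, (U'.getD i []).length = (N.getD i []).length ∧
      ∀ t, i < N.length → t < (N.getD i []).length →
        g ∣ (N.getD i []).getD t 0 ∧ (U'.getD i []).getD t 0 = (N.getD i []).getD t 0 / g := by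
  unfold divRows at h
  split_ifs at h with hall
  simp only [Option.some.injEq] at h
  subst h
  refine ⟨by simp, fun i => ⟨?_, fun t hi ht => ?_⟩⟩
  · rw [List.getD_eq_getElem?_getD, List.getElem?_map]
    cases hN : N[i]? with
    | none =>
      rw [List.getD_eq_getElem?_getD (l := N), hN]
      simp
    | some row =>
      rw [List.getD_eq_getElem?_getD (l := N), hN]
      simp
  · have hrow : N.getD i [] = N[i] := by
      rw [List.getD_eq_getElem?_getD, List.getElem?_eq_getElem hi, Option.getD_some]
    have hmemrow : N[i] ∈ N := List.getElem_mem hi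
    have hall' := List.all_eq_true.1 (List.all_eq_true.1 hall _ hmemrow)
    rw [hrow] at ht ⊢
    have hx : (N[i]).getD t 0 = (N[i])[t] := by
      rw [List.getD_eq_getElem?_getD, List.getElem?_eq_getElem ht, Option.getD_some]
    refine ⟨?_, ?_⟩
    · have := hall' _ (hx ▸ List.getElem_mem ht)
      rw [beq_iff_eq] at this
      exact Int.dvd_of_emod_eq_zero this
    · have h1 : (List.map (fun row => List.map (fun x => x / g) row) N).getD i [] = List.map (fun x => x / g) (N[i]) := by
        rw [List.getD_eq_getElem?_getD, List.getElem?_map, List.getElem?_eq_getElem hi]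
        simp
      rw [h1, hx, List.getD_eq_getElem?_getD, List.getElem?_map, List.getElem?_eq_getElem ht]
      simp

/-- **What a successful content step computes** — the conclusion of `bzStep_spec` with the divisor
`g = max 1 (content)`. [cite: Bareiss1968, §I eq. (8), p. 565] -/
theorem stepC_spec {a : ℤ} {b : List ℤ} {rs U' : List (List ℤ)} (hlen : b.length = rs.length)
    (h : stepC a b rs = some U') :
    U'.length = rs.length ∧
    ∀ i, i < rs.length →
      (U'.getD i []).length = min (rs.getD i []).length (b.length - i) ∧
      ∀ t, t < (rs.getD i []).length → i + t < b.length →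
        (max 1 (content (bzRows a b rs) : ℤ)) ∣ (a * (rs.getD i []).getD t 0 - b.getD i 0 * b.getD (i + t) 0) ∧
        (U'.getD i []).getD t 0 = (a * (rs.getD i []).getD t 0 - b.getD i 0 * b.getD (i + t) 0) / (max 1 (content (bzRows a b rs) : ℤ)) := by
  unfold stepC at h
  obtain ⟨hUl, hU⟩ := divRows_spec h
  obtain ⟨hNl, hN⟩ := bzRows_spec (a := a) b rs
  have hNlen := hNl hlen
  refine ⟨by rw [hUl, hNlen], fun i hi => ?_⟩
  have hib : i < b.length := by rw [hlen]; exact hi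
  obtain ⟨hl, hent⟩ := hN i hi hib
  obtain ⟨hUl_i, hUi⟩ := hU i
  refine ⟨by rw [hUl_i, hl], fun t ht hbt => ?_⟩
  have htN : t < ((bzRows a b rs).getD i []).length := by
    rw [hl]; exact lt_min ht (by omega)
  obtain ⟨hdvd, hval⟩ := hUi t (by rw [hNlen]; exact hi) htN
  rw [hent t ht hbt] at hdvd hval
  exact ⟨hdvd, hval⟩

/-- The divisor of a content step is positive. [folklore] -/
private theorem divisorC_pos (a : ℤ) (b : List ℤ) (rs : List (List ℤ)) :
    (0 : ℤ) < max 1 (content (bzRows a b rs) : ℤ) :=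
  lt_of_lt_of_le one_pos (le_max_left _ _)

/-- Entry identity of a content step, stored triangle. [cite: Bareiss1968, §I eq. (8), p. 565] -/
private theorem stepC_entry_le {a : ℤ} {k : ℕ} {b : List ℤ} {rs U' : List (List ℤ)} (hb : b.length = k)
    (hrs : upperShape k rs = true) (h : stepC a b rs = some U') (i j : Fin k) (hij : i ≤ j) :
    (max 1 (content (bzRows a b rs) : ℤ)) * symOfUpper k U' i j
      = a * symOfUpper k rs i j - b.getD i.val 0 * b.getD j.val 0 := by
  have hk : rs.length = k := length_of_upperShape hrs
  obtain ⟨_, hspec⟩ := stepC_spec (by rw [hb, hk]) h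
  have hi : i.val < rs.length := by rw [hk]; exact i.isLt
  have hrow : (rs.getD i.val []).length = k - i.val := getD_length_of_upperShape hrs i.val i.isLt
  obtain ⟨_, ht⟩ := hspec i.val hi
  have hle : i.val ≤ j.val := hij
  obtain ⟨hdvd, hval⟩ := ht (j.val - i.val) (by rw [hrow]; omega) (by rw [hb]; omega)
  rw [Nat.add_sub_cancel' hle] at hdvd hval
  simp only [symOfUpper, if_pos hle]
  rw [hval]
  exact Int.mul_ediv_cancel' hdvd

/-- Entry identity of a content step, all entries. [cite: Bareiss1968, §I eq. (8), p. 565] -/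
theorem stepC_entry {a : ℤ} {k : ℕ} {b : List ℤ} {rs U' : List (List ℤ)} (hb : b.length = k)
    (hrs : upperShape k rs = true) (h : stepC a b rs = some U') (i j : Fin k) :
    (max 1 (content (bzRows a b rs) : ℤ)) * symOfUpper k U' i j
      = a * symOfUpper k rs i j - b.getD i.val 0 * b.getD j.val 0 := by
  rcases le_total i j with hij | hji
  · exact stepC_entry_le hb hrs h i j hij
  · rw [symOfUpper_comm k U' i j, symOfUpper_comm k rs i j, mul_comm (b.getD i.val 0),
      stepC_entry_le hb hrs h j i hji]

/-- A content step preserves the shape. [folklore] -/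
private theorem upperShape_of_stepC {a : ℤ} {k : ℕ} {b : List ℤ} {rs U' : List (List ℤ)} (hb : b.length = k)
    (hrs : upperShape k rs = true) (h : stepC a b rs = some U') : upperShape k U' = true := by
  have hk : rs.length = k := length_of_upperShape hrs
  obtain ⟨hlen, hspec⟩ := stepC_spec (by rw [hb, hk]) h
  refine upperShape_of_lengths k U' (by rw [hlen, hk]) fun i hi => ?_
  obtain ⟨hl, _⟩ := hspec i (by rw [hk]; exact hi)
  rw [hl, getD_length_of_upperShape hrs i hi, hb]
  omega

/-- **SOUNDNESS of the content-divisor decision.** The induction of `posSemidef_symOfUpper_of_bzDecide`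
with the divisor `g = max 1 (content)` in place of the previous pivot.
[cite: CollowaldHubert2015, §4.1 Corollary 4.2, §4.2 Proposition 4.4] [cite: HornJohnson2013, §7.1 Observation 7.1.10] -/
theorem posSemidef_symOfUpper_of_bzDecideC : ∀ (k : ℕ) (U : List (List ℤ)),
    upperShape k U = true → bzDecideC k U = true →
    ((symOfUpper k U).map (Int.cast : ℤ → ℝ)).PosSemidef
  | 0, U, _, _ => posSemidef_fin_zero _
  | _ + 1, [], hsh, _ => by simp [upperShape] at hsh
  | k + 1, [] :: rs, hsh, _ => by
    have := (upperShape_cons hsh).1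
    simp at this
  | k + 1, (a :: b) :: rs, hsh, h => by
    obtain ⟨hlen, hrs⟩ := upperShape_cons hsh
    have hb : b.length = k := by simpa using hlen
    have hblock : ((symOfUpper (k + 1) ((a :: b) :: rs)).map (Int.cast : ℤ → ℝ)).submatrix (pivotEquiv k) (pivotEquiv k)
        = Matrix.fromBlocks (Matrix.of fun (_ _ : Unit) => (a : ℝ))
            (Matrix.of fun (_ : Unit) (j : Fin k) => ((b.getD j.val 0 : ℤ) : ℝ))
            (Matrix.of fun (_ : Unit) (j : Fin k) => ((b.getD j.val 0 : ℤ) : ℝ))ᵀ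
            ((symOfUpper k rs).map (Int.cast : ℤ → ℝ)) := by
      rw [Matrix.submatrix_map, symOfUpper_cons_submatrix_pivotEquiv, Matrix.fromBlocks_map]
      rfl
    rw [← Matrix.posSemidef_submatrix_equiv (pivotEquiv k), hblock]
    simp only [bzDecideC] at h
    split_ifs at h with hneg hzero
    · rw [Bool.and_eq_true] at h
      obtain ⟨hball, hrec⟩ := h
      have hD := posSemidef_symOfUpper_of_bzDecideC k rs hrs hrec
      have hB : (Matrix.of fun (_ : Unit) (j : Fin k) => ((b.getD j.val 0 : ℤ) : ℝ)) = 0 := by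
        ext u j
        have hj : j.val < b.length := by rw [hb]; exact j.isLt
        have hmem : b.getD j.val 0 ∈ b := by
          rw [List.getD_eq_getElem?_getD, List.getElem?_eq_getElem hj, Option.getD_some]
          exact List.getElem_mem hj
        have hz := List.all_eq_true.1 hball _ hmem
        rw [beq_iff_eq] at hz
        rw [Matrix.of_apply, Matrix.zero_apply, hz, Int.cast_zero]
      have hA : (Matrix.of fun (_ _ : Unit) => (a : ℝ)) = 0 := by
        ext ⟨⟩ ⟨⟩
        simp [hzero]
      rw [hA, hB]
      exact (PsdZeroPivotRule.posSemidef_fromBlocks_zero₁₁_iff _ _).2 ⟨rfl, hD⟩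
    · have ha : 0 < a := lt_of_le_of_ne (not_lt.mp hneg) (Ne.symm hzero)
      cases hstep : stepC a b rs with
      | none => rw [hstep] at h; simp at h
      | some U' =>
        rw [hstep] at h
        have hshU : upperShape k U' = true := upperShape_of_stepC hb hrs hstep
        have hN := posSemidef_symOfUpper_of_bzDecideC k U' hshU h
        apply (PsdZeroPivotRule.posSemidef_fromBlocks_posDef₁₁_iff (posDef_of_unit (by exact_mod_cast ha)) _ _).2
        have ha' : (a : ℝ) ≠ 0 := by exact_mod_cast ha.ne'
        have hg := divisorC_pos a b rs
        have hg' : (0 : ℝ) < ((max 1 (content (bzRows a b rs) : ℤ) : ℤ) : ℝ) := by exact_mod_cast hg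
        have key : (symOfUpper k rs).map (Int.cast : ℤ → ℝ)
            - (Matrix.of fun (_ : Unit) (j : Fin k) => ((b.getD j.val 0 : ℤ) : ℝ))ᵀ
                * (Matrix.of fun (_ _ : Unit) => (a : ℝ))⁻¹
                * (Matrix.of fun (_ : Unit) (j : Fin k) => ((b.getD j.val 0 : ℤ) : ℝ))
            = ((((max 1 (content (bzRows a b rs) : ℤ) : ℤ) : ℝ)) / a) • (symOfUpper k U').map (Int.cast : ℤ → ℝ) := by
          rw [inv_of_unit ha']
          ext i j
          have hz := stepC_entry hb hrs hstep i j
          have hc : (((max 1 (content (bzRows a b rs) : ℤ) : ℤ) : ℝ)) * ((symOfUpper k U' i j : ℤ) : ℝ)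
              = ((a : ℤ) : ℝ) * ((symOfUpper k rs i j : ℤ) : ℝ)
                - ((b.getD i.val 0 : ℤ) : ℝ) * ((b.getD j.val 0 : ℤ) : ℝ) := by
            exact_mod_cast hz
          simp only [Matrix.sub_apply, Matrix.mul_apply, Matrix.transpose_apply, Matrix.of_apply, Matrix.map_apply,
            Matrix.smul_apply, smul_eq_mul, Finset.univ_unique, Finset.sum_singleton]
          rw [div_mul_eq_mul_div, hc]
          field_simp
        rw [key]
        exact hN.smul (div_nonneg hg'.le (by exact_mod_cast ha.le))

/-- **SOUNDNESS of the content-divisor check.** [cite: CollowaldHubert2015, §4.1 Corollary 4.2] -/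
theorem posSemidef_symOfUpper_of_bzCheckC {k : ℕ} {U : List (List ℤ)} (h : bzCheckC k U = true) :
    ((symOfUpper k U).map (Int.cast : ℤ → ℝ)).PosSemidef := by
  rw [bzCheckC, Bool.and_eq_true] at h
  exact posSemidef_symOfUpper_of_bzDecideC k U h.1 h.2

/-- A presented block accepted by `bzCheckC` is PSD (`d > 0`). [cite: CollowaldHubert2015, §4.1 Corollary 4.2] -/
theorem posSemidef_zblock_map_of_bzCheckC {k d : ℕ} {U : List (List ℤ)} (hd : 0 < d) (h : bzCheckC k U = true) :
    ((zblock k d U).map (Rat.cast : ℚ → ℝ)).PosSemidef := by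
  have e : (zblock k d U).map (Rat.cast : ℚ → ℝ) = ((d : ℝ)⁻¹) • (symOfUpper k U).map (Int.cast : ℤ → ℝ) := by
    ext i j
    simp [zblock, div_eq_inv_mul]
  rw [e]
  exact (posSemidef_symOfUpper_of_bzCheckC h).smul (inv_nonneg.2 (by exact_mod_cast hd.le))

/-- **Batched content-divisor check** of presentation data. [cite: CollowaldHubert2015, §4.1 Corollary 4.2] -/
def bzCheckAllC (data : List (List (Fin N) × ℕ × List (List ℤ))) : Bool :=
  data.all fun t => decide (0 < t.2.1) && bzCheckC t.1.length t.2.2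

/-- Window of the batched content-divisor check. [cite: CollowaldHubert2015, §4.1 Corollary 4.2] -/
def bzCheckWindowC (lo len : ℕ) (data : List (List (Fin N) × ℕ × List (List ℤ))) : Bool :=
  bzCheckAllC ((data.drop lo).take len)

/-- Unfolding of the window. [cite: CollowaldHubert2015, §4.1 Corollary 4.2] -/
theorem bzCheckWindowC_eq (lo len : ℕ) (data : List (List (Fin N) × ℕ × List (List ℤ))) :
    bzCheckWindowC lo len data = bzCheckAllC ((data.drop lo).take len) := rfl

/-- **Every block of data accepted by `bzCheckAllC` is positive semidefinite.**
[cite: ZhengFantuzziPapachristodoulou2018, §3.2 Theorem 2 («if» direction)] [cite: CollowaldHubert2015, §4.1 Corollary 4.2] -/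
theorem forall_posSemidef_zblocks_of_bzCheckAllC {data : List (List (Fin N) × ℕ × List (List ℤ))}
    (h : bzCheckAllC data = true) : ∀ b ∈ zblocks N data, (b.2.map (Rat.cast : ℚ → ℝ)).PosSemidef := by
  intro b hb
  rw [zblocks, List.mem_map] at hb
  obtain ⟨t, ht, rfl⟩ := hb
  have hc := List.all_eq_true.1 h t ht
  rw [Bool.and_eq_true, decide_eq_true_eq] at hc
  exact posSemidef_zblock_map_of_bzCheckC hc.1 hc.2

/-- Windows make the whole, content variant. [cite: CollowaldHubert2015, §4.1 Corollary 4.2] -/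
theorem bzCheckAllC_of_windows {data : List (List (Fin N) × ℕ × List (List ℤ))} (len k : ℕ)
    (hk : data.length ≤ k * len) (h : ∀ t : Fin k, bzCheckWindowC (t.val * len) len data = true) :
    bzCheckAllC data = true := by
  apply List.all_eq_true.2
  intro b hb
  obtain ⟨i, hi, rfl⟩ := List.getElem_of_mem hb
  have hlen : 0 < len := by
    rcases Nat.eq_zero_or_pos len with h0 | h0
    · subst h0
      rw [Nat.mul_zero] at hk
      omega
    · exact h0
  have htk : i / len < k :=
    Nat.div_lt_of_lt_mul (lt_of_lt_of_le hi (by rwa [Nat.mul_comm] at hk))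
  have hw := h ⟨i / len, htk⟩
  rw [bzCheckWindowC_eq] at hw
  have ha1 : i / len * len ≤ i := Nat.div_mul_le_self i len
  have ha2 : i < i / len * len + len := Nat.lt_div_mul_add hlen
  have hmem : data[i] ∈ (data.drop (i / len * len)).take len := by
    rw [List.mem_iff_getElem]
    refine ⟨i - i / len * len, ?_, ?_⟩
    · rw [List.length_take, List.length_drop]
      omega
    · rw [List.getElem_take, List.getElem_drop]
      congr 1
      omega
  exact List.all_eq_true.1 hw _ hmem

/-- **The same from `k` window decides**, content variant. [cite: CollowaldHubert2015, §4.1 Corollary 4.2] -/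
theorem forall_posSemidef_zblocks_of_windowsC {data : List (List (Fin N) × ℕ × List (List ℤ))} (len k : ℕ)
    (hk : data.length ≤ k * len) (h : ∀ t : Fin k, bzCheckWindowC (t.val * len) len data = true) :
    ∀ b ∈ zblocks N data, (b.2.map (Rat.cast : ℚ → ℝ)).PosSemidef :=
  forall_posSemidef_zblocks_of_bzCheckAllC (bzCheckAllC_of_windows len k hk h)

/-- **End to end, sparse target, content variant.**
[cite: ZhengFantuzziPapachristodoulou2018, §3.2 Theorem 2 («if» direction)] -/
theorem posSemidef_map_of_cliqueSweepS_bzC {rows : List (SRow ℚ)} {data : List (List (Fin N) × ℕ × List (List ℤ))}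
    (h : cliqueSweepS N 0 N rows (zblocks N data) = true) (hz : bzCheckAllC data = true) :
    ((matrixOfSparseRows N N rows).map (Rat.cast : ℚ → ℝ)).PosSemidef :=
  posSemidef_map_of_cliqueSweepS h (forall_posSemidef_zblocks_of_bzCheckAllC hz)

section ExamplesC

/-- The `3 × 3` example through the content variant (step 1 numerators `8, 4, 8` have content `4`). -/
example : bzCheckC 3 [[4, 2, 2], [3, 1], [3]] = true := by decide +kernel

/-- Rejections as before. -/
example : bzCheckC 2 [[1, 2], [1]] = false ∧ bzCheckC 2 [[0, 1], [5]] = false := by decide +kernel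

/-- A block whose entries share the factor `6`: contents `36, 6` are divided out on the way. -/
example : bzCheckC 3 [[12, 6, 6], [18, 6], [(12 : ℤ)]] = true := by decide +kernel

/-- Soundness in use. -/
example : ((symOfUpper 3 [[12, 6, 6], [18, 6], [(12 : ℤ)]]).map (Int.cast : ℤ → ℝ)).PosSemidef :=
  posSemidef_symOfUpper_of_bzCheckC (by decide +kernel)

end ExamplesC

end Literature.Computation.Certificates.PSD
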